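import Summits.QuantumAdvantage.AdviceFreeQNC0.PerOutputFormsFibre39
import HarnessLib

/-!
# Cell qa-qnc0, `p = 3` — (J2) on a PREFIX FIBRE of the walk game: letters and forms restrict, and the class closure WITH WALK WINDOWS
# (prover qn-prover-3 g28; groundwork for the charge independence of `BlockFibre37.PerOutputGatesHardConst`, file `PerOutputGatesCharge39`)

(J2) (`BlockCombJoin37`): output `g` = a table `F g` of its own `r` dense `𝔽₃`-forms AND of its walk window of radius `(log₂ n)^C`, every charge
`c`.  For (J3) the suffix fibre sufficed (`PerOutputFormsFibre39` / `PerOutputFormsFrame39`); for (J2) the outside triple must be written onto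
rows ADJACENT to the outside outputs (E4 uses rows `0, 1`), so here the FIRST three walk bits `a` are fixed: input `glue3 a w b` with
`a : Fin 3 → Bool`, window `w : Fin n → Bool`, `b : Fin 0 → Bool` empty; fibre charge `inCharge c a b = c + 3 + 2|a|`.

* `uExt_glue3_prefix`, `xOfU_glue3_prefix_succ` / `_three` / `_lt` — big bit `m + 3` is window bit `m` (for ALL `m`, the convention `u_n = 1`
  included); big letter `m + 3` (`m ≥ 1`) is window letter `m`, big letter `3` is `a₂ ⊕ x'_0`, letters `< 3` are constant;
* ★ `gateSum_glue3_prefix` — `∃ ℓ' κ, ∀ w, gateSum ℓ (glue3 a w b) = gateSum ℓ' w + κ`;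
* `glue3_prefix_agree` — window agreement of `w, v` transfers to `glue3 a w b, glue3 a v b`;
* ★ `gatesFibre_eq` — CLASS CLOSURE: `∃ ℓ' F'` over `Fin (#(Fin r ⊕ Fin 3 × Fin r)) = 4r` forms per output such that the fibre strategy is
  `F' g' (forms') w` at charge `c + 3 + 2|a|`, AND `F' · t` is window-local of radius `R'` whenever the big tables are window-local of radius `R`
  with `R + 1 ≤ R'` (rows `0, 1` read the outside outputs' tables — big bits `< 3 + R` — and the bit `w₀`).

WHAT THIS IS NOT: no hardness statement (counting and `PerOutputGatesHardConst` from its top charge are in `PerOutputGatesCharge39`); (J2) is OPEN;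
crux `stmt-QuantumAdvantage-22907` untouched; no ledger item (D-0168 shelf).
-/

noncomputable section

namespace Summit.QuantumAdvantage.AdviceFreeQNC0

open Classical
open Finset
open Literature.Computability.MetaComplexity

namespace BlockFibre37

variable {n : ℕ}

/-! ### §1 Letters and forms on a prefix fibre (prefix of `3` bits, window of `n` bits, empty suffix) -/

/-- the window block is read at positions `m + 3`. -/
private theorem glue3_prefix_window (a : Fin 3 → Bool) (w : Fin n → Bool) (b : Fin 0 → Bool) {m : ℕ} (hm : m < n)
    (h : m + 3 < 3 + n + 0) : glue3 a w b ⟨m + 3, h⟩ = w ⟨m, hm⟩ := by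
  have e : (⟨m + 3, h⟩ : Fin (3 + n + 0)) = Fin.castAdd 0 (Fin.natAdd 3 ⟨m, hm⟩) := Fin.ext (by simp; omega)
  rw [e]; unfold glue3; rw [Fin.append_left, Fin.append_right]

/-- the prefix block is read at positions `< 3`. -/
private theorem glue3_prefix_left (a : Fin 3 → Bool) (w : Fin n → Bool) (b : Fin 0 → Bool) {m : ℕ} (hm : m < 3)
    (h : m < 3 + n + 0) : glue3 a w b ⟨m, h⟩ = a ⟨m, hm⟩ := by
  have e : (⟨m, h⟩ : Fin (3 + n + 0)) = Fin.castAdd 0 (Fin.castAdd n ⟨m, hm⟩) := Fin.ext (by simp)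
  rw [e]; unfold glue3; rw [Fin.append_left, Fin.append_left]

/-- **Big bit `m + 3` is window bit `m`** (for every `m`, conventions `u_{|u|} = 1` on both sides). -/
theorem uExt_glue3_prefix (a : Fin 3 → Bool) (w : Fin n → Bool) (b : Fin 0 → Bool) (m : ℕ) :
    uExt (glue3 a w b) (m + 3) = uExt w m := by
  unfold uExt
  by_cases hm : m < n
  · rw [dif_pos (show m + 3 < 3 + n + 0 by omega), dif_pos hm, glue3_prefix_window a w b hm]
  · rw [dif_neg (show ¬ m + 3 < 3 + n + 0 by omega), dif_neg hm]

/-- Prefix bits do not read `w`. -/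
theorem uExt_glue3_prefix_lt (a : Fin 3 → Bool) (w w₀ : Fin n → Bool) (b : Fin 0 → Bool) {m : ℕ} (hm : m < 3) :
    uExt (glue3 a w b) m = uExt (glue3 a w₀ b) m := by
  unfold uExt
  rw [dif_pos (show m < 3 + n + 0 by omega), dif_pos (show m < 3 + n + 0 by omega),
    glue3_prefix_left a w b hm, glue3_prefix_left a w₀ b hm]

/-- **Window letters**: big letter `m + 3` (`m ≥ 1`) is window letter `m`. -/
theorem xOfU_glue3_prefix_succ (a : Fin 3 → Bool) (w : Fin n → Bool) (b : Fin 0 → Bool) {m : ℕ} (hm : 1 ≤ m)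
    (h1 : m + 3 < 3 + n + 0 + 1) (h2 : m < n + 1) :
    xOfU (glue3 a w b) ⟨m + 3, h1⟩ = xOfU w ⟨m, h2⟩ := by
  unfold xOfU
  rw [if_neg (show (⟨m + 3, h1⟩ : Fin (3 + n + 0 + 1)).val ≠ 0 by simp),
    if_neg (show (⟨m, h2⟩ : Fin (n + 1)).val ≠ 0 by simp; omega)]
  show (!(xor (uExt (glue3 a w b) (m + 3)) (uExt (glue3 a w b) (m + 3 - 1)))) = !(xor (uExt w m) (uExt w (m - 1)))
  rw [uExt_glue3_prefix, show m + 3 - 1 = (m - 1) + 3 by omega, uExt_glue3_prefix]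

/-- **The first window letter flips with `a₂`**: `x_3(glue3 a w b) = a₂ ⊕ x'_0(w)`. -/
theorem xOfU_glue3_prefix_three (a : Fin 3 → Bool) (w : Fin n → Bool) (b : Fin 0 → Bool)
    (h1 : 3 < 3 + n + 0 + 1) :
    xOfU (glue3 a w b) ⟨3, h1⟩ = xor (a ⟨2, by omega⟩) (xOfU w ⟨0, Nat.succ_pos n⟩) := by
  unfold xOfU
  rw [if_neg (show (⟨3, h1⟩ : Fin (3 + n + 0 + 1)).val ≠ 0 by simp),
    if_pos (show (⟨0, Nat.succ_pos n⟩ : Fin (n + 1)).val = 0 by simp)]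
  show (!(xor (uExt (glue3 a w b) 3) (uExt (glue3 a w b) (3 - 1)))) = xor (a ⟨2, _⟩) (!(xor (uExt w 0) false))
  have e3 : uExt (glue3 a w b) 3 = uExt w 0 := uExt_glue3_prefix a w b 0
  have e2 : uExt (glue3 a w b) (3 - 1) = a ⟨2, by omega⟩ := by
    unfold uExt; rw [dif_pos (show 3 - 1 < 3 + n + 0 by omega)]
    exact glue3_prefix_left a w b (by omega) _
  rw [e3, e2, Bool.xor_false]
  generalize a ⟨2, _⟩ = a2
  cases a2 <;> cases uExt w 0 <;> rfl

/-- **Prefix letters** do not depend on `w`. -/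
theorem xOfU_glue3_prefix_lt (a : Fin 3 → Bool) (w w₀ : Fin n → Bool) (b : Fin 0 → Bool) (j : Fin (3 + n + 0 + 1))
    (hj : j.val < 3) : xOfU (glue3 a w b) j = xOfU (glue3 a w₀ b) j := by
  unfold xOfU
  rw [uExt_glue3_prefix_lt a w w₀ b hj]
  by_cases h0 : j.val = 0
  · rw [if_pos h0, if_pos h0]
  · rw [if_neg h0, if_neg h0, uExt_glue3_prefix_lt a w w₀ b (show j.val - 1 < 3 by omega)]

/-- **Forms restrict to forms** on the prefix fibre: every dense form of the big game is a dense form of the window game plus a constant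
(the coefficient of `x'_0` is negated when `a₂ = 1`). -/
theorem gateSum_glue3_prefix (L : Fin (3 + n + 0 + 1) → ZMod 3) (a : Fin 3 → Bool) (b : Fin 0 → Bool) :
    ∃ (L' : Fin (n + 1) → ZMod 3) (κ : ZMod 3), ∀ w : Fin n → Bool, gateSum L (glue3 a w b) = gateSum L' w + κ := by
  set w₀ : Fin n → Bool := fun _ => false with hw₀
  set F₀ : ℕ → ZMod 3 := fun m =>
    if h : m < 3 + n + 0 + 1 then (if xOfU (glue3 a w₀ b) ⟨m, h⟩ = true then L ⟨m, h⟩ else 0) else 0 with hF₀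
  set L' : Fin (n + 1) → ZMod 3 := fun i =>
    if i.val = 0 then (if a ⟨2, by omega⟩ = true then -L ⟨3, by omega⟩ else L ⟨3, by omega⟩)
    else L ⟨i.val + 3, by omega⟩ with hL'
  refine ⟨L', (if a ⟨2, by omega⟩ = true then L ⟨3, by omega⟩ else 0) + ∑ m ∈ Finset.Ico 0 3, F₀ m, fun w => ?_⟩
  set F : ℕ → ZMod 3 := fun m =>
    if h : m < 3 + n + 0 + 1 then (if xOfU (glue3 a w b) ⟨m, h⟩ = true then L ⟨m, h⟩ else 0) else 0 with hF
  set G : ℕ → ZMod 3 := fun m =>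
    if h : m < n + 1 then (if xOfU w ⟨m, h⟩ = true then L' ⟨m, h⟩ else 0) else 0 with hG
  have hLsum : gateSum L (glue3 a w b) = ∑ m ∈ Finset.Ico 0 (3 + n + 0 + 1), F m := by
    unfold gateSum; rw [Finset.sum_fin_eq_sum_range, Finset.range_eq_Ico]
  have hRsum : gateSum L' w = ∑ m ∈ Finset.Ico 0 (n + 1), G m := by
    unfold gateSum; rw [Finset.sum_fin_eq_sum_range, Finset.range_eq_Ico]
  rw [hLsum, hRsum, ← Finset.sum_Ico_consecutive F (show 0 ≤ 3 by omega) (show 3 ≤ 3 + n + 0 + 1 by omega),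
    ← Finset.sum_Ico_consecutive F (show 3 ≤ 4 by omega) (show 4 ≤ 3 + n + 0 + 1 by omega),
    show Finset.Ico 3 4 = {3} from rfl, Finset.sum_singleton,
    ← Finset.sum_Ico_consecutive G (show 0 ≤ 1 by omega) (show 1 ≤ n + 1 by omega),
    show Finset.Ico 0 1 = {0} from rfl, Finset.sum_singleton]
  -- the prefix part
  have h1 : ∑ m ∈ Finset.Ico 0 3, F m = ∑ m ∈ Finset.Ico 0 3, F₀ m := by
    refine Finset.sum_congr rfl fun m hm => ?_
    have hm3 : m < 3 := (Finset.mem_Ico.mp hm).2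
    have e1 : F m = (if xOfU (glue3 a w b) ⟨m, by omega⟩ = true then L ⟨m, by omega⟩ else 0) := by
      rw [hF]; exact dif_pos (by omega)
    have e2 : F₀ m = (if xOfU (glue3 a w₀ b) ⟨m, by omega⟩ = true then L ⟨m, by omega⟩ else 0) := by
      rw [hF₀]; exact dif_pos (by omega)
    rw [e1, e2, xOfU_glue3_prefix_lt a w w₀ b ⟨m, by omega⟩ (by exact hm3)]
  -- the window part, shifted by `3`
  have h3 : ∑ m ∈ Finset.Ico 4 (3 + n + 0 + 1), F m = ∑ m ∈ Finset.Ico 1 (n + 1), G m := by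
    rw [show 3 + n + 0 + 1 = (n + 1) + 3 by omega, show (4 : ℕ) = 1 + 3 from rfl, ← Finset.sum_Ico_add' F 1 (n + 1) 3]
    refine Finset.sum_congr rfl fun m hm => ?_
    have hm' : 1 ≤ m ∧ m < n + 1 := Finset.mem_Ico.mp hm
    have e1 : F (m + 3) = (if xOfU (glue3 a w b) ⟨m + 3, by omega⟩ = true then L ⟨m + 3, by omega⟩ else 0) := by
      rw [hF]; exact dif_pos (by omega)
    have e2 : G m = (if xOfU w ⟨m, hm'.2⟩ = true then L' ⟨m, hm'.2⟩ else 0) := by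
      rw [hG]; exact dif_pos hm'.2
    have e3 : L' ⟨m, hm'.2⟩ = L ⟨m + 3, by omega⟩ := by
      rw [hL']; exact if_neg (show (⟨m, hm'.2⟩ : Fin (n + 1)).val ≠ 0 by simp; omega)
    rw [e1, e2, e3, xOfU_glue3_prefix_succ a w b hm'.1]
  -- the boundary letter `3`
  have h2 : F 3 = G 0 + (if a ⟨2, by omega⟩ = true then L ⟨3, by omega⟩ else 0) := by
    have e1 : F 3 = (if xOfU (glue3 a w b) ⟨3, by omega⟩ = true then L ⟨3, by omega⟩ else 0) := by
      rw [hF]; exact dif_pos (by omega)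
    have e2 : G 0 = (if xOfU w ⟨0, Nat.succ_pos n⟩ = true then L' ⟨0, Nat.succ_pos n⟩ else 0) := by
      rw [hG]; exact dif_pos (Nat.succ_pos n)
    have e3 : L' ⟨0, Nat.succ_pos n⟩ =
        (if a ⟨2, by omega⟩ = true then -L ⟨3, by omega⟩ else L ⟨3, by omega⟩) := by
      rw [hL']; exact if_pos rfl
    rw [e1, e2, e3, xOfU_glue3_prefix_three a w b]
    generalize a ⟨2, _⟩ = a2
    cases a2 <;> cases xOfU w ⟨0, Nat.succ_pos n⟩ <;> simp
  rw [h1, h2, h3]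
  ring

/-- **Window agreement transfers to the glued inputs**: if `w, v` agree on the window bits `i'` whose big position `i' + 3` lies in
`[G − R, G + R)`, then `glue3 a w b, glue3 a v b` agree on every big bit in `[G − R, G + R)` (prefix bits agree anyway). -/
theorem glue3_prefix_agree (a : Fin 3 → Bool) (w v : Fin n → Bool) (b : Fin 0 → Bool) {G R : ℕ}
    (h : ∀ i' : Fin n, G ≤ i'.val + 3 + R → i'.val + 3 < G + R → w i' = v i') (i : Fin (3 + n + 0))
    (h1 : G ≤ i.val + R) (h2 : i.val < G + R) : glue3 a w b i = glue3 a v b i := by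
  by_cases hi : i.val < 3
  · have e : i = ⟨i.val, i.isLt⟩ := rfl
    rw [e, glue3_prefix_left a w b hi, glue3_prefix_left a v b hi]
  · have hlt : i.val - 3 < n := by have := i.isLt; omega
    have e : i = ⟨(i.val - 3) + 3, by have := i.isLt; omega⟩ := Fin.ext (by simp; omega)
    rw [e, glue3_prefix_window a w b hlt, glue3_prefix_window a v b hlt]
    exact h ⟨i.val - 3, hlt⟩ (by simp; omega) (by simp; omega)

/-! ### §2 Class closure with walk windows -/

/-- ★ **CLASS CLOSURE FOR (J2).**  On the prefix fibre `{glue3 a w b : w}` (first three walk bits fixed to `a`), the (J2)-strategy with tables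
`F g` (reading `r` dense forms and a walk window) IS a (J2)-strategy of the window game on `n` bits with `r' = #(Fin r ⊕ Fin 3 × Fin r) = 4r` forms
per output — own restricted forms and the three outside outputs' restricted forms, through which (together with the outside outputs' walk windows
and the bit `w₀`) E4's rows `0, 1` read the even outside triple — at the charge `c + 3 + 2|a|`; and if the big tables are window-local of radius
`R` then the new tables are window-local of any radius `R' ≥ R + 1` (the outside outputs sit at positions `< 3`, next to rows `0, 1`). -/
theorem gatesFibre_eq (hn : 1 ≤ n) (r : ℕ) {R R' : ℕ} (hRR : R + 1 ≤ R')
    (ℓ : Fin (3 + n + 0 + 1) → Fin r → Fin (3 + n + 0 + 1) → ZMod 3)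
    (F : Fin (3 + n + 0 + 1) → (Fin r → ZMod 3) → (Fin (3 + n + 0) → Bool) → Bool)
    (hloc : ∀ t, WindowLocal R (fun g u => F g t u)) (c : ℕ) (a : Fin 3 → Bool) (b : Fin 0 → Bool) :
    ∃ (ℓ' : Fin (n + 1) → Fin (Fintype.card (Fin r ⊕ (Fin 3 × Fin r))) → Fin (n + 1) → ZMod 3)
      (F' : Fin (n + 1) → (Fin (Fintype.card (Fin r ⊕ (Fin 3 × Fin r))) → ZMod 3) → (Fin n → Bool) → Bool),
      (∀ t, WindowLocal R' (fun g w => F' g t w)) ∧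
      ∀ w : Fin n → Bool,
        ringWinU c (fun g u => F g (fun i => gateSum (ℓ g i) u) u) (glue3 a w b) =
          ringWinU (c + 3 + 2 * wt a) (fun g w => F' g (fun i => gateSum (ℓ' g i) w) w) w := by
  -- restricted forms, one per (output of the big game, form index)
  choose L' κ hL using fun (g : Fin (3 + n + 0 + 1)) (i : Fin r) => gateSum_glue3_prefix (ℓ g i) a b
  set S := Fin r ⊕ (Fin 3 × Fin r) with hS
  set e : Fin (Fintype.card S) ≃ S := (Fintype.equivFin S).symm with he
  set y : Fin (3 + n + 0 + 1) → (Fin (3 + n + 0) → Bool) → Bool :=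
    fun g u => F g (fun i => gateSum (ℓ g i) u) u with hy
  -- the fibre charge, as an OPAQUE variable (a transparent `inCharge c a b` makes `whnf` evaluate `wt a` on `Fin 3 → Bool`)
  obtain ⟨c', hc'⟩ : ∃ c' : ℕ, inCharge c a b = c' := ⟨_, rfl⟩
  -- window / outside positions of the big game
  set gin : Fin (n + 1) → Fin (3 + n + 0 + 1) := fun g' => ⟨3 + g'.val, by omega⟩ with hgin
  set gout : Fin 3 → Fin (3 + n + 0 + 1) := fun t => ⟨t.val, by omega⟩ with hgout
  -- the outside triple read through the outside outputs' restricted forms and walk windows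
  set Ψ : ℕ → (Fin 3 → Fin r → ZMod 3) → (Fin n → Bool) → Bool := fun s V w =>
    decide ((univ.filter fun t : Fin 3 =>
      F (gout t) (fun i => V t i + κ (gout t) i) (glue3 a w b) = true ∧ gapChar n c a b (gout t).val s % 3 ≠ 0).card % 2 = 1)
    with hΨ
  set Lsum : Fin (n + 1) → S → (Fin (n + 1) → ZMod 3) := fun g' =>
    Sum.elim (fun i => L' (gin g') i) (fun ti => L' (gout ti.1) ti.2) with hLsum
  set Fsum : Fin (n + 1) → (S → ZMod 3) → (Fin n → Bool) → Bool := fun g' V w =>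
    xor (if g'.val = 0 then
        xor (Ψ (((3 - c' % 3) % 3 + 2) % 3) (fun t i => V (Sum.inr (t, i))) w)
          (Ψ ((3 - c' % 3) % 3) (fun t i => V (Sum.inr (t, i))) w && w ⟨0, hn⟩)
      else if g'.val = 1 then Ψ ((3 - c' % 3) % 3) (fun t i => V (Sum.inr (t, i))) w else false)
      (F (gin g') (fun i => V (Sum.inl i) + κ (gin g') i) (glue3 a w b)) with hFsum
  -- E4's two rows for the outside triple (the strategy of `ringWinU_tripleRows`, kept as a lambda)
  have hE4 := fun w => ringWinU_tripleRows hn c' (outParity y c a b) (outParity_even c y a b) w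
  -- the charge of the fibre
  have hb : wt b = 0 := by
    unfold wt; rw [Finset.univ_eq_empty, Finset.filter_empty, Finset.card_empty]
  have hcharge : c' % 3 = (c + 3 + 2 * wt a) % 3 := by
    rw [← hc']; unfold inCharge; rw [hb]; omega
  -- (a) the window outputs
  have hin : ∀ (g' : Fin (n + 1)) (w' : Fin n → Bool),
      inStrategy y a b g' w' = F (gin g') (fun i => gateSum (L' (gin g') i) w' + κ (gin g') i) (glue3 a w' b) := by
    intro g' w'
    have e1 : inStrategy y a b g' w' =
        F (gin g') (fun i => gateSum (ℓ (gin g') i) (glue3 a w' b)) (glue3 a w' b) := rfl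
    rw [e1]
    congr 1
    funext i
    exact hL _ i w'
  -- (b) the outside triple
  have hP : ∀ (s : ℕ) (w' : Fin n → Bool),
      outParity y c a b s w' = Ψ s (fun t i => gateSum (L' (gout t) i) w') w' := by
    intro s w'
    have hcard : (univ.filter fun g : Fin (3 + n + 0 + 1) => (g.val < 3 ∨ 3 + n < g.val) ∧
          y g (glue3 a w' b) = true ∧ gapChar n c a b g.val s % 3 ≠ 0).card =
        (univ.filter fun t : Fin 3 =>
          F (gout t) (fun i => gateSum (L' (gout t) i) w' + κ (gout t) i) (glue3 a w' b) = true ∧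
            gapChar n c a b (gout t).val s % 3 ≠ 0).card := by
      refine Finset.card_bij (fun (g : Fin (3 + n + 0 + 1)) hg =>
          (⟨g.val, by rw [Finset.mem_filter] at hg; have := g.isLt; omega⟩ : Fin 3)) ?_ ?_ ?_
      · intro g hg
        have hg' := hg
        rw [Finset.mem_filter] at hg'
        obtain ⟨-, hrange, hyg, hgap⟩ := hg'
        have hg3 : g.val < 3 := by have := g.isLt; omega
        have hgo : gout ⟨g.val, hg3⟩ = g := Fin.ext (by simp [hgout])
        rw [Finset.mem_filter]
        refine ⟨Finset.mem_univ _, ?_, ?_⟩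
        · rw [hgo, ← hyg]; simp only [hy, hL]
        · rw [hgo]; exact hgap
      · intro g₁ hg₁ g₂ hg₂ h
        have h' := congrArg Fin.val h
        apply Fin.ext
        simp only at h'
        exact h'
      · intro t ht
        rw [Finset.mem_filter] at ht
        refine ⟨gout t, ?_, Fin.ext (by simp [hgout])⟩
        rw [Finset.mem_filter]
        refine ⟨Finset.mem_univ _, Or.inl (by simp [hgout]), ?_, ht.2.2⟩
        rw [← ht.2.1]; simp only [hy, hL]
    unfold outParity outCount
    rw [hcard]
  refine ⟨fun g' j => Lsum g' (e j), fun g' v w => Fsum g' (fun s => v (e.symm s)) w, ?_, fun w => ?_⟩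
  · -- window-locality of the new tables
    intro v g' w w' hagree
    have hown : F (gin g') (fun i => v (e.symm (Sum.inl i)) + κ (gin g') i) (glue3 a w b)
        = F (gin g') (fun i => v (e.symm (Sum.inl i)) + κ (gin g') i) (glue3 a w' b) := by
      refine hloc _ (gin g') _ _ fun i hi1 hi2 => glue3_prefix_agree a w w' b (G := 3 + g'.val) (R := R)
        (fun i' h1' h2' => hagree i' (by omega) (by omega)) i hi1 hi2
    have hout : g'.val ≤ 1 → ∀ s, Ψ s (fun t i => v (e.symm (Sum.inr (t, i)))) w
        = Ψ s (fun t i => v (e.symm (Sum.inr (t, i)))) w' := by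
      intro hg1 s
      have hfil : (univ.filter fun t : Fin 3 =>
            F (gout t) (fun i => v (e.symm (Sum.inr (t, i))) + κ (gout t) i) (glue3 a w b) = true ∧
              gapChar n c a b (gout t).val s % 3 ≠ 0) =
          univ.filter fun t : Fin 3 =>
            F (gout t) (fun i => v (e.symm (Sum.inr (t, i))) + κ (gout t) i) (glue3 a w' b) = true ∧
              gapChar n c a b (gout t).val s % 3 ≠ 0 := by
        refine Finset.filter_congr fun t _ => ?_
        have ht3 : (gout t).val < 3 := by simp [hgout]
        have hh : F (gout t) (fun i => v (e.symm (Sum.inr (t, i))) + κ (gout t) i) (glue3 a w b)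
            = F (gout t) (fun i => v (e.symm (Sum.inr (t, i))) + κ (gout t) i) (glue3 a w' b) :=
          hloc _ (gout t) (glue3 a w b) (glue3 a w' b) fun i hi1 hi2 =>
            glue3_prefix_agree a w w' b (G := (gout t).val) (R := R)
              (fun i' h1' h2' => hagree i' (by omega) (by omega)) i hi1 hi2
        rw [hh]
      simp only [hΨ, hfil]
    have h0 : g'.val ≤ 1 → w ⟨0, hn⟩ = w' ⟨0, hn⟩ := fun hg1 => hagree ⟨0, hn⟩ (by simp; omega) (by simp; omega)
    show Fsum g' (fun s => v (e.symm s)) w = Fsum g' (fun s => v (e.symm s)) w'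
    simp only [hFsum]
    rw [hown]
    by_cases hg0 : g'.val = 0
    · rw [if_pos hg0, if_pos hg0, hout (by omega), hout (by omega), h0 (by omega)]
    · by_cases hg1 : g'.val = 1
      · rw [if_neg hg0, if_neg hg0, if_pos hg1, if_pos hg1, hout (by omega)]
      · rw [if_neg hg0, if_neg hg0, if_neg hg1, if_neg hg1]
  · -- the fibre identity
    show ringWinU c y (glue3 a w b) = _
    rw [ringWinU_glue3_eq_mixedWinU c y a w b]
    unfold mixedWinU
    rw [hc', ← hE4 w, ← ringWinU_xor n c' _ (inStrategy y a b) w, ringWinU_charge_mod hcharge]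
    congr 1
    funext g' w'
    simp only [hFsum, hLsum, Equiv.apply_symm_apply, Sum.elim_inl, Sum.elim_inr, hin, hP]

end BlockFibre37

end Summit.QuantumAdvantage.AdviceFreeQNC0

end
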